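import Literature.NumberTheory.EllipticCurves.CastellaLiuWan2022.GreenbergDivisibilityAwayFromCyclotomic
import HarnessLib

/-!
# Castella–Liu–Wan, Forum Math. Sigma **10** (2022) e110, Thm. 8.2.1 (p. 85) and §6.1 (p. 51) — the two-variable
# Greenberg divisibility AWAY FROM THE CYCLOTOMIC VARIABLE with a FREE branch character, read on a quadratic twist
# `E = V₀ ⊗ χ_D` of a SEMISTABLE curve `V₀/ℚ` good at `p` by `D = p*·d`, `d ≡ 1 (mod 4)` prime to `p` with every prime
# of `d` split in `𝒦` (D-0014: STATEMENT ONLY — two named facts, siblings of the `…_pStarTwist` facts of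
# `GreenbergDivisibilityAwayFromCyclotomic.lean` (the case `d = 1`); same frames, same value display; NO instance,
# NO notation, nothing asserted about any curve)

Filed by the LEAD seat `cruxlead-stmt-BirchSwinnertonDyer-19357` (gen 13, cell `pub/bsd-addord`; brief:
`Summits/BirchSwinnertonDyer/BirchSwinnertonDyer/Cruxes/GordTwoRankZeroOffCaseOne/LeadReport21.md` §2). PURPOSE: the
three-field road on crux 19357 consumes print Thm. 8.2.1 through `thm821_XGr₂_charIdeal_mul_le_awayFromCyc_pStarTwist`, whose
E-currency instance pins the CLW representation `π` to `π_V`, `V ≅ E^{(p*)}`; that forces `E` to be SEMISTABLE OUTSIDE `p`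
(`N_V` square-free). When the other additive primes `ℓ` of `E` are of quadratic-twist type, the semistable curve is instead
`V₀ ≅ E^{(p*·d)}`, `d = ∏ ℓ*` (tree: `TwistTypePartnerData.exists_semistable_partner_data`), and print Thm. 8.2.1 applies
VERBATIM to `π = π_{V₀}` with the branch character `ξ := ω^{(p+1)/2} · (χ_d ∘ N_{𝒦/ℚ})` — §5.2 fixes `ξ` only as "an algebraic
Hecke character of ∞-type `(0, k₀)` with `k₀` an even integer" and Thm. 8.2.1 (IMPRIMITIVE, p. 85) carries NO further condition
on `ξ` (module docstring of the sibling file, "Source of record"; the conditions of Prop. 8.2.2 / Thm. 8.2.3 are not used there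
and are not used here).

## The reading (deltas against the sibling file's (E), (ξ), (R), (V), (O), (Γ⁺), (S), (T) — everything not listed is verbatim)

(E′) THE INSTANCE. `V₀/ℚ` globally minimal with `N_{V₀}` square-free and `p ∤ N_{V₀}` (binders `Squarefree NV`, `¬ p ∣ NV` —
print §5.2: `π_v` unramified / Steinberg / unramified-quadratic-twisted Steinberg at every finite `v`, `π_p` unramified), `W` the
globally minimal model of `E = V₀ ⊗ χ_D`, `D = p*·d` (`∃ C, C • W^{(p*·d)} = V₀`; `(W^{(D)})^{(D)} ≅ W`), with `d ≡ 1 (mod 4)`,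
`p ∤ d`, and every prime `ℓ ∣ d` SPLIT in `𝒦` (three new binders). `f = f_E` of level `N = N_E`. CLW's `π` IS `π_{V₀}`; the
remaining §5.2 clauses are the sibling's binders on `V₀` verbatim (`∃ q ∣ N_{V₀}` not split in `𝒦`; `2` not split `→ 2 ∣ N_{V₀}`;
`V₀[p]|_{G_𝒦}` irreducible).
(ξ′) THE BRANCH CHARACTER. `ξ := ω^{(p+1)/2} · (χ_d ∘ N_{𝒦/ℚ})` — finite order, ∞-type `(0,0)`, `k₀ = 0` even (allowed by §5.2;
its conductor, supported above `p` and the primes of `d`, is free in Thm. 8.2.1). With `T_π = T_pV₀(−1)`: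
`T_π(ε²)(ξ⁻¹) = T_pV₀ ⊗ εξ⁻¹ = T_pV₀ ⊗ χ_{p*} χ_d ⊗ ⟨ε⟩ = T_pE ⊗ ⟨ε⟩` (`ω^{(p−1)/2} = χ_{p*}`, `χ_{p*}χ_d = χ_D`, both
quadratic), so — exactly as in (ξ) — `X_{π,𝒦,ξ} = tw^*(X_Gr(E/𝒦̃_∞))` is the tree's `WeierstrassCurve.XGr₂ (W.baseChange 𝒦) p κ₁ κ₂ 𝔭′ γ₁ γ₂`
and the value of `tw(𝓛)` at the geometric avatar of `ρ := ξτ·|·|⁻¹·(χ_D ∘ N)` is `𝓛(τ_{p-adic})`.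
(V′) THE VALUE DISPLAY IS UNCHANGED (`clwInterpolationValue f 𝔭′ ρ m b Ω_∞ C`, `f = f_E`). Above `p`: `(ξ₀τ₀)_𝔭̄ = χ_{D,p}·ν =
χ_{p*,p}·χ_{d,p}·ν` with `χ_{d,p}` UNRAMIFIED quadratic (`p ∤ d`), so each of the two abelian `ε`-factors of (V) is multiplied by
`χ_{d,p}(p) = ±1` and their product by `χ_{d,p}(p)² = 1`: `γ_p = (−1)^{(p−1)/2} ρ(ϖ_𝔭̄)⁻²` verbatim. Away from `p`:
`BC(π_{V₀}) ⊗ ξ₀τ₀ = BC(π_{V₀} ⊗ χ_D) ⊗ (ω-part)τ₀`-twist `= BC(π_E)`-twist at every place, so `L^{{∞,p}}` is the Euler product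
of `L(f_E/𝒦, ρ, s)` at `s = 1` as before; at a place `w ∣ ℓ ∣ d` (ℓ SPLIT: `𝒦_w = ℚ_ℓ`) the representation
`π_{E,ℓ} = π_{V₀,ℓ} ⊗ χ_{D,ℓ}` is a RAMIFIED quadratic twist of an unramified or Steinberg representation, whose automorphic
`L`-factor (twisted by the unramified `τ_w`) is `1` — equal to the naive factor of `rankinSelbergValueHecke f ρ 1` at `w`
(`a_ℓ(f_E) = 0`, `ℓ² ∣ N_E`), the same mechanism as the sibling's remark at `p`. (This is why the primes of `d` are required to
split: at an inert or ramified `w` the base-changed twist could become less ramified and the two local factors could differ.)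
(S′) IMPRIMITIVITY. Print's `Σ` (§5.6) now also contains the primes of `d` (where `ξ` ramifies); the Euler-factor element
`B = ∏_{w∈S} 𝒫_w` of `IsEulerFactorAway₂` has `𝒫_w = 1` at `w ∣ ℓ ∣ d` (the inverse naive Euler factor of `L(f_E/𝒦, ρ, s)` at an
additive prime is `1`), and `B(0,·) ≠ 0` by the sibling's argument at the other places. The JSW Euler-factor sentence
(`char(X^S) = char(X)·∏ 𝒫_w`, proof of print Thm. 8.2.3 (1)) is quoted for ALL `w ∤ p`, additive places included.
(R), (O), (Γ⁺), (T): verbatim. WEAKER than print in the same ways as the sibling (crystalline sub-range, `𝒪_{ℂ_p}`-coefficients,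
torsion hypothesis, free unit constant `C`); never knowingly stronger. The case `d = 1` is the sibling fact (same binders after
`simp`), so nothing typed earlier is restated in a stronger form.

## NOT typed here
Everything listed under "NOT typed / NOT in print" in the sibling file; the anticyclotomic-restriction sentence for this branch;
twists by `d ≢ 1 (mod 4)` (additive `2` of twist type) and primes of `d` inert or ramified in `𝒦` — not needed by the consumer
and requiring a separate local check at `2` / at `w`.

## References
* [CastellaLiuWan2022] F. Castella, Z. Liu, X. Wan, Forum Math. Sigma 10 (2022) e110, doi 10.1017/fms.2022.95: §1 (1.0.1)–(1.0.3)
  (pp. 2–3), §5.2 "Our setup" (p. 34: `ξ` "an algebraic Hecke character … of ∞-type `(0, k₀)` with `k₀` an even integer"),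
  §5.6 (p. 38: `Σ` contains "the finite places `v ≠ p` where `π` or `ξ` or `𝒦/ℚ` is ramified"), (6.1.2) (p. 51), Thm. 8.2.1
  (p. 85), proof of Thm. 8.2.3 (1) (p. 88). arXiv:2109.08375v1 [corpus: paper:arxiv-2109.08375 p0003, p0023, p0055–p0057].
* [JetchevSkinnerWan2017] CJM 5 (2017), proof of Thm. 6.1.6 (arXiv:1512.06894 Thm. 36, p0026).
* [Wan2020RankinSelbergIMC] ANT 14 (2020) §2 (reciprocity normalised by geometric Frobenius).
* Sibling: `Literature/NumberTheory/EllipticCurves/CastellaLiuWan2022/GreenbergDivisibilityAwayFromCyclotomic.lean` (typer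
  `bsd-addord-ty-clw1`), whose frames `clwInterpolationValue`, `IsCastellaLiuWanLFunction₂`, `IsEulerFactorAway₂` are reused.
-/

noncomputable section

open scoped Classical

open PowerSeries NumberField IsDedekindDomain Field CongruenceSubgroup
  Literature.NumberTheory.GaloisRepresentations Literature.NumberTheory.EllipticCurves
  Literature.NumberTheory.EllipticCurves.ModularForms

namespace Literature.NumberTheory.EllipticCurves.CastellaLiuWan2022

open IwasawaAlgebra₂

universe u

/-! ## The named facts (semistable-twist reading) -/

/-- **Castella–Liu–Wan, Forum Math. Sigma 10 (2022) e110, Theorem 8.2.1 (p. 85) — the two-variable Greenberg divisibility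
AWAY FROM THE CYCLOTOMIC VARIABLE with a FREE branch character — composed with the Euler-factor sentence of the proof of
Theorem 8.2.3 (1) (p. 88), read on the quadratic twist `E = V₀ ⊗ χ_D` of a SEMISTABLE `V₀` good at `p`, `D = p*·d`.**
PRINT: "For an imaginary quadratic field `𝒦`, a prime `p ≥ 3` split in `𝒦` and `π, ξ` as in §5.2 [`π_v` unramified or
(unramified-quadratic-twisted) Steinberg at every finite `v`; `π_p` unramified; a prime `q` not split in `𝒦` with `π` ramified
at `q`, and `π` ramified at `2` if `2` does not split; `ρ̄_π|_{G_𝒦}` irreducible; `ξ` algebraic of ∞-type `(0, k₀)`, `k₀` even],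
`(𝓛^{Σ∪{ℓ,ℓ′}}_{π,𝒦,ξ}) ⊇ char_𝓡(X^{Σ∪{ℓ,ℓ′}}_{π,𝒦,ξ} ⊗ 𝓡)` as ideals of `𝓡 = 𝒪^{ur}_L⟦Γ_𝒦⟧ ⊗_{𝒪_L⟦Γ⁺_𝒦⟧} Frac(𝒪_L⟦Γ⁺_𝒦⟧)`";
and (p. 88) "the sizes of the unramified cohomology groups at primes outside `p` are controlled by the local Euler factors of
the `p`-adic `L`-functions". TRANSCRIBED exactly as the sibling `thm821_XGr₂_charIdeal_mul_le_awayFromCyc_pStarTwist`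
(module docstring (E), (ξ), (R), (V), (O), (Γ⁺), (S), (T) of `GreenbergDivisibilityAwayFromCyclotomic.lean`) with `π := π_{V₀}`
and `ξ := ω^{(p+1)/2}·(χ_d ∘ N_{𝒦/ℚ})` (this file's (E′), (ξ′), (V′), (S′)): `V₀` (binder `V`) globally minimal with `N_{V₀}`
square-free, `p ∤ N_{V₀}`, `p` odd; `W` the globally minimal model of `E = V₀ ⊗ χ_{p*·d}` (`∃ C, C • W^{(p*·d)} = V₀`) with
`d ≡ 1 (mod 4)`, `p ∤ d`, every prime of `d` split in `𝒦`; `f = f_E` of level `N = N_E`; `𝒦` imaginary quadratic, `p = 𝔭𝔭′`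
split, `𝔭` induced by `ι`; `∃ q ∣ N_{V₀}` not split in `𝒦`; `2` not split `→ 2 ∣ N_{V₀}`; `V₀[p]|_{G_𝒦}` irreducible; `κ₂`
ANTICYCLOTOMIC with ANY completing pair `(κ₁; γ₁, γ₂)`; `X ↦ XGr₂ (W.baseChange 𝒦) p κ₁ κ₂ 𝔭′ γ₁ γ₂`, assumed `Λ₂`-torsion.
THEN for every CLW pair `(A, B)` for `f_E` with genuine period data and every structure map `J : ℤ_p → 𝒪_{ℂ_p}` there is
`0 ≠ h ∈ 𝒪_{ℂ_p}⟦T₁⟧` with `h(T₁)·B·y ∈ (A)` for every `y ∈ char_{Λ₂}(XGr₂)·𝒪_{ℂ_p}⟦T₂⟧⟦T₁⟧`. The case `d = 1` is the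
sibling fact. WEAKER than print (crystalline sub-range, `𝒪_{ℂ_p}`-coefficients, torsion hypothesis, free unit constant);
READING (O); never knowingly stronger.
[cite: CastellaLiuWan2022, Thm. 8.2.1 p. 85 with (8.2.1), proof of Thm. 8.2.3 (1) p. 88, §5.2 p. 34, §5.6 p. 38, §1 (1.0.1)–(1.0.3) pp. 2–3, (6.1.2) p. 51 (Forum Math. Sigma 10 (2022) e110 = arXiv:2109.08375v1 Thm. 8.2.1 (1), paper:arxiv-2109.08375 p0055)]
[cite: JetchevSkinnerWan2017, proof of Thm. 6.1.6 (arXiv:1512.06894 Thm. 36, paper:arxiv-1512.06894 p0026 L77–L100)]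
[cite: Wan2020RankinSelbergIMC, §2 (reciprocity map normalised by geometric Frobenius; ANT 14 p. 389, paper:arxiv-1408.4044 p0006)] -/
def thm821_XGr₂_charIdeal_mul_le_awayFromCyc_semistableTwist : Prop :=
  ∀ {p : ℕ} [Fact p.Prime] (ι : PadicAlgCl p ≃+* ℂ) (V W : WeierstrassCurve ℚ) [V.IsElliptic]
    [V.IsGloballyMinimal] [W.IsElliptic] [W.IsGloballyMinimal] (K : Type) [Field K] [NumberField K]
    (𝔭 𝔭' : HeightOneSpectrum (𝓞 K)) (κ₁ κ₂ : ZpExtension K p) (γ₁ γ₂ : absoluteGaloisGroup K)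
    [Fact (ZpExtension.IsTopGeneratorPair κ₁ κ₂ γ₁ γ₂)] {N : ℕ} [NeZero N]
    {f : CuspForm (Gamma0 N) 2} (_ : IsNewformOf W f) (NV : ℕ) (d : ℤ),
    -- `E = W`, the quadratic twist of the SEMISTABLE `V` by `D = p*·d` (`V` = the minimal model of `W^{(D)}`); `f = f_E`
    (∃ C : WeierstrassCurve.VariableChange ℚ, C • W.quadraticTwist ((-1 : ℚ) ^ (p / 2) * p * d) = V) →
    -- the extra twist parameter `d`: `d ≡ 1 (mod 4)`, prime to `p`, every prime of `d` SPLIT in `𝒦`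
    d % 4 = 1 → ¬ (p : ℤ) ∣ d →
    (∀ ℓ : ℕ, ℓ.Prime → (ℓ : ℤ) ∣ d → ((Ideal.span {(ℓ : ℤ)}).primesOver (𝓞 K)).ncard = 2) →
    (N : ℤ) = W.conductorNorm ℤ → (NV : ℤ) = V.conductorNorm ℤ →
    -- §5.2 on `π = π_V`: semistable everywhere, unramified at the odd prime `p`
    p ≠ 2 → Squarefree NV → ¬ p ∣ NV →
    -- `𝒦` imaginary quadratic, `p = 𝔭𝔭′` split, `𝔭` the prime induced by `ι`
    IsImaginaryQuadratic K → ((Ideal.span {(p : ℤ)}).primesOver (𝓞 K)).ncard = 2 →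
    ((p : ℕ) : 𝓞 K) ∈ 𝔭.asIdeal → ((p : ℕ) : 𝓞 K) ∈ 𝔭'.asIdeal → 𝔭' ≠ 𝔭 →
    (∀ (w : InfinitePlace K) (k : 𝓞 K), k ∈ 𝔭.asIdeal ↔ ‖ι.symm (w.embedding (k : K))‖ < 1) →
    -- §5.2: a prime `q` not split in `𝒦` with `π_q` ramified; `π` ramified at `2` if `2` does not split
    (∃ q : ℕ, q.Prime ∧ q ∣ NV ∧ ((Ideal.span {(q : ℤ)}).primesOver (𝓞 K)).ncard ≠ 2) →
    (((Ideal.span {(2 : ℤ)}).primesOver (𝓞 K)).ncard ≠ 2 → 2 ∣ NV) →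
    -- §5.2: `ρ̄_π|_{G_𝒦}` irreducible
    (V.baseChange K).HasIrreducibleModPGaloisRep p →
    -- the tower: `κ₂` anticyclotomic (so `Γ⁺_𝒦` is generated by the image of `γ₁`); `κ₁` arbitrary
    κ₂.IsAnticyclotomic →
    -- (T): `X` torsion (print: otherwise `char := (0)` and the inclusion is automatic)
    Module.IsTorsion (IwasawaAlgebra₂ p) ((W.baseChange K).XGr₂ p κ₁ κ₂ 𝔭' γ₁ γ₂) →
    -- every CLW pair `(A, B)` with genuine period data
    ∀ (Ωinf C : ℂ) (Ωp : (unrIntegers p)ˣ) (A B : PowerSeries (PowerSeries (PadicComplexInt p))),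
      Ωinf ≠ 0 → ‖((ι.symm C : PadicAlgCl p) : ℂ_[p])‖ = 1 →
      IsCastellaLiuWanLFunction₂ ι 𝔭' κ₁ κ₂ γ₁ γ₂ f Ωinf C ((Ωp : unrIntegers p) : ℂ_[p]) A B →
    -- along every structure map `ℤ_p → 𝒪_{ℂ_p}`
    ∀ J : ℤ_[p] →+* PadicComplexInt p,
      (∀ x : ℤ_[p], ((J x : PadicComplexInt p) : ℂ_[p]) = ((x : ℚ_[p]) : ℂ_[p])) →
    -- `∃ 0 ≠ h ∈ 𝒪⟦Γ⁺⟧ = 𝒪⟦T₁⟧`, `h · B · char(X) Λ^{ur} ⊆ (A)`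
    ∃ h : PowerSeries (PadicComplexInt p), h ≠ 0 ∧
      ∀ y ∈ (WeierstrassCurve.XGr₂.charIdeal (W.baseChange K) p κ₁ κ₂ 𝔭' γ₁ γ₂).map (toUnr₂ p J),
        PowerSeries.map (PowerSeries.C : PadicComplexInt p →+* PowerSeries (PadicComplexInt p)) h *
            B * y ∈ Ideal.span {A}

/-- **Castella–Liu–Wan, Forum Math. Sigma 10 (2022) e110, §6.1 (p. 51): EXISTENCE of the two-variable `S`-imprimitive `p`-adic
`L`-function — "By [EW16] (and the Archimedean computation in [EL]), there exists a (unique) `p`-adic `L`-function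
`𝓛^{Σ∪{ℓ,ℓ′}}_{π,𝒦,ξ} ∈ 𝒪̂^{ur}_L⟦Γ_𝒦⟧ ⊗_ℤ ℚ` satisfying the interpolation property [(6.1.2)]" — read on `E = V₀ ⊗ χ_{p*·d}`
as the existence of a CLW pair `(A, B)` for `f_E` with an Euler-factor denominator.** Under the hypotheses of
`thm821_XGr₂_charIdeal_mul_le_awayFromCyc_semistableTwist` on `(V₀, W, d, 𝒦, p, 𝔭, 𝔭′)` (§5.2 for `π_{V₀}`; no torsion hypothesis,
no Selmer group) and for every pair `(κ₁, κ₂; γ₁, γ₂)` with `κ₂` anticyclotomic: there are `Ω_∞ ≠ 0`, `Ω_p ∈ R₀ˣ`, a unit constant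
`C`, a finite set `S` of finite primes of `𝒦` NOT above `p` (the primes over print's `Σ ∪ {ℓ,ℓ′}` — §5.6: `2`, `q`, the ramified
places of `π_{V₀}`, of `ξ` (here: the primes of `d` as well) and of `𝒦/ℚ` other than `p`, the primes of `𝔰`, and `ℓ, ℓ′`), an
exponent `k` and series `A, B` with `B` the Euler-factor element of `S` for `f_E` (`IsEulerFactorAway₂`; `𝒫_w = 1` at the additive
places `w ∣ d`), `(A, p^k·B)` a CLW pair for `f_E` (`IsCastellaLiuWanLFunction₂`), and `B(0,·) ≠ 0`. Sibling of
`sec61_exists_isCastellaLiuWanLFunction₂_pStarTwist` (the case `d = 1`); module docstring (E′), (ξ′), (V′), (S′). WEAKER than print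
(no uniqueness, no `Λ^{ur}`-rationality, crystalline range, free unit `C`); READING (O).
[cite: CastellaLiuWan2022, §6.1 p. 51 ((6.1.2) and the existence sentence), §5.1 p. 33 (Ω_∞, Ω_p), §5.2 p. 34, §5.6 p. 38 (Σ) (Forum Math. Sigma 10 (2022) e110; arXiv:2109.08375v1 Rmk. 1.0.2, paper:arxiv-2109.08375 p0003)]
[cite: JetchevSkinnerWan2017, §5.1 Rmk. after Prop. 5.1.x (= arXiv:1512.06894 Rmk. 25, paper:arxiv-1512.06894 p0022) and proof of Thm. 6.1.6 (arXiv Thm. 36)] -/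
def sec61_exists_isCastellaLiuWanLFunction₂_semistableTwist : Prop :=
  ∀ {p : ℕ} [Fact p.Prime] (ι : PadicAlgCl p ≃+* ℂ) (V W : WeierstrassCurve ℚ) [V.IsElliptic]
    [V.IsGloballyMinimal] [W.IsElliptic] [W.IsGloballyMinimal] (K : Type) [Field K] [NumberField K]
    (𝔭 𝔭' : HeightOneSpectrum (𝓞 K)) (κ₁ κ₂ : ZpExtension K p) (γ₁ γ₂ : absoluteGaloisGroup K)
    [Fact (ZpExtension.IsTopGeneratorPair κ₁ κ₂ γ₁ γ₂)] {N : ℕ} [NeZero N]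
    {f : CuspForm (Gamma0 N) 2} (_ : IsNewformOf W f) (NV : ℕ) (d : ℤ),
    (∃ C : WeierstrassCurve.VariableChange ℚ, C • W.quadraticTwist ((-1 : ℚ) ^ (p / 2) * p * d) = V) →
    -- the extra twist parameter `d`: `d ≡ 1 (mod 4)`, prime to `p`, every prime of `d` SPLIT in `𝒦`
    d % 4 = 1 → ¬ (p : ℤ) ∣ d →
    (∀ ℓ : ℕ, ℓ.Prime → (ℓ : ℤ) ∣ d → ((Ideal.span {(ℓ : ℤ)}).primesOver (𝓞 K)).ncard = 2) →
    (N : ℤ) = W.conductorNorm ℤ → (NV : ℤ) = V.conductorNorm ℤ →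
    p ≠ 2 → Squarefree NV → ¬ p ∣ NV →
    IsImaginaryQuadratic K → ((Ideal.span {(p : ℤ)}).primesOver (𝓞 K)).ncard = 2 →
    ((p : ℕ) : 𝓞 K) ∈ 𝔭.asIdeal → ((p : ℕ) : 𝓞 K) ∈ 𝔭'.asIdeal → 𝔭' ≠ 𝔭 →
    (∀ (w : InfinitePlace K) (k : 𝓞 K), k ∈ 𝔭.asIdeal ↔ ‖ι.symm (w.embedding (k : K))‖ < 1) →
    (∃ q : ℕ, q.Prime ∧ q ∣ NV ∧ ((Ideal.span {(q : ℤ)}).primesOver (𝓞 K)).ncard ≠ 2) →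
    (((Ideal.span {(2 : ℤ)}).primesOver (𝓞 K)).ncard ≠ 2 → 2 ∣ NV) →
    (V.baseChange K).HasIrreducibleModPGaloisRep p →
    κ₂.IsAnticyclotomic →
    ∃ (Ωinf C : ℂ) (Ωp : (unrIntegers p)ˣ) (S : Finset (HeightOneSpectrum (𝓞 K))) (k : ℕ)
      (A B : PowerSeries (PowerSeries (PadicComplexInt p))),
      Ωinf ≠ 0 ∧ ‖((ι.symm C : PadicAlgCl p) : ℂ_[p])‖ = 1 ∧
      (∀ w ∈ S, ((p : ℕ) : 𝓞 K) ∉ w.asIdeal) ∧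
      IsEulerFactorAway₂ ι S κ₁ κ₂ γ₁ γ₂ f B ∧
      IsCastellaLiuWanLFunction₂ ι 𝔭' κ₁ κ₂ γ₁ γ₂ f Ωinf C ((Ωp : unrIntegers p) : ℂ_[p]) A
        (PowerSeries.C (PowerSeries.C (((p : ℕ) : PadicComplexInt p) ^ k)) * B) ∧
      PowerSeries.constantCoeff B ≠ 0

end Literature.NumberTheory.EllipticCurves.CastellaLiuWan2022

end
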